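import Summits.BirchSwinnertonDyer.BirchSwinnertonDyer.Theorems.EisensteinDepletionAtTwoStarGO2CuspEvennessELeg
import HarnessLib

/-!
# Cusp-evenness, part 3: clauses (o), (ii-a), (iii) of `stub_gammaOneCover`

Part of the cusp-evenness package for line `kummer` of crux `StarGO2Sigma` (stmt-BirchSwinnertonDyer-27046), written by
planner bsd-rank2-p2 GEN 36 (HOME/p2/g36/lean/CuspEvenness.lean, `lean check` rc 0, 0 sorries; memo HOME/p2/g36/CUSP-EVENNESS.md;
numerics kit j312110) and landed verbatim, split into four files for the 400-line rule, by the lead star-p1 GEN 11.  The full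
mathematical overview is the module docstring of `EisensteinDepletionAtTwoStarGO2CuspEvennessParabolic.lean` (part 1).  This part: §5 — the generator has ‖g′‖₂ = 2⁻³ exactly, parabolic values are EVEN multiples of g′ off the exceptional levels, and an odd Bézout value exists.
BSD is not proved by this file; nothing here reads `r_an`.
-/


set_option linter.dupNamespace false
set_option autoImplicit false

open scoped MatrixGroups
open CongruenceSubgroup Matrix.SpecialLinearGroup

namespace Summit.BirchSwinnertonDyer.BirchSwinnertonDyer.Theorems.DepletionAtTwo.CuspEvenness

open Literature.NumberTheory.ModularForms

/-! ### §5 Cusp-evenness of the Eisenstein class: clauses (o), (ii-a), (iii) of the lead's `stub_gammaOneCover` -/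

section Core

variable {N : ℕ} {β : ℕ → ℕ}

/-- `Int.gcd ↑t c = Nat.gcd t |c|`. [folklore] -/
theorem int_gcd_natCast_left (t : ℕ) (c : ℤ) : Int.gcd (t : ℤ) c = t.gcd c.natAbs := by
  rw [Int.gcd_eq_natAbs, Int.natAbs_natCast]

/-- An admissible level has a prime factor, so `1 < N`. [cite: Stevens1982, §2.4 (unfolding)] -/
theorem one_lt_of_admissible (hadm : IsAdmissibleStabData N β) : 1 < N := by
  obtain ⟨ℓ, hℓ⟩ : ∃ ℓ, ℓ ∈ N.primeFactors := by
    rcases hadm.2.2 with ⟨ℓ, hℓ, -⟩ | ⟨⟨ℓ, hℓ, -⟩, -⟩ <;> exact ⟨ℓ, hℓ⟩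
  have hN : N ≠ 0 := (Nat.mem_primeFactors.mp hℓ).2.2
  have := Nat.le_of_dvd (Nat.pos_of_ne_zero hN) (Nat.dvd_of_mem_primeFactors hℓ)
  have := (Nat.prime_of_mem_primeFactors hℓ).two_le
  omega

/-- `φ_β(−γ) = φ_β(γ)` when every `t ∣ N` divides the lower-left entry. [cite: RademacherGrosswald1972, Ch. 4 A, eq. (62)] -/
theorem stabEisensteinPeriod_neg_of_dvd {a b c d : ℤ} (hc : (N : ℤ) ∣ c) :
    stabEisensteinPeriod N β (-a) (-b) (-c) (-d) = stabEisensteinPeriod N β a b c d := by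
  rw [stabEisensteinPeriod_eq, stabEisensteinPeriod_eq]
  refine Finset.sum_congr rfl fun t ht ↦ ?_
  have htc : (t : ℤ) ∣ c := dvd_trans (Int.natCast_dvd_natCast.mpr (Nat.dvd_of_mem_divisors ht)) hc
  rw [mul_neg, Int.neg_ediv_of_dvd htc, rademacherPhi_neg]

/-- `φ_β` on the lower unipotents of `Γ₀(N)`: `φ_β(1, 0; k, 1) = −k·c_β`, `c_β = ∑ c_t/t`.
[cite: RademacherGrosswald1972, Ch. 4 A, eq. (59)] -/
theorem stabEisensteinPeriod_lower (hN : N ≠ 0) (hadm : IsAdmissibleStabData N β) {k : ℤ} (hk : (N : ℤ) ∣ k) :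
    stabEisensteinPeriod N β 1 0 k 1 = -k * ∑ t ∈ N.divisors, stabCoeff N β t / t := by
  have h := stabEisensteinPeriod_parabolic hN hadm (a := 0) (c := 1) isCoprime_one_right (-k)
    (by simpa using (dvd_neg).mpr hk)
  simp only [mul_zero, sq, sub_zero, add_zero, mul_one, neg_neg, Int.gcd_one_right,
    Nat.cast_one] at h
  rw [h]
  push_cast
  ring

/-- `n·g'` with `‖n g'‖₂ ≤ 2⁻⁴` and `‖g'‖₂ ≥ 2⁻³` forces `n` even. [folklore] -/
theorem even_of_norm_mul_le {n : ℤ} {g' : ℚ} (hg' : 8⁻¹ ≤ ‖((g' : ℚ) : ℚ_[2])‖)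
    (hx : ‖((n * g' : ℚ) : ℚ_[2])‖ ≤ (2 : ℝ) ^ (-(4 : ℤ))) : Even n := by
  rw [Rat.cast_mul, Rat.cast_intCast, norm_mul] at hx
  have hn1 : ‖(n : ℚ_[2])‖ < 1 := by
    by_contra hge
    push Not at hge
    have : (8 : ℝ)⁻¹ ≤ (2 : ℝ) ^ (-(4 : ℤ)) :=
      calc (8 : ℝ)⁻¹ ≤ ‖((g' : ℚ) : ℚ_[2])‖ := hg'
        _ = 1 * ‖((g' : ℚ) : ℚ_[2])‖ := (one_mul _).symm
        _ ≤ ‖(n : ℚ_[2])‖ * ‖((g' : ℚ) : ℚ_[2])‖ := by gcongr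
        _ ≤ (2 : ℝ) ^ (-(4 : ℤ)) := hx
    norm_num at this
  rw [Padic.norm_intCast_lt_one_iff] at hn1
  exact even_iff_two_dvd.mpr (by exact_mod_cast hn1)

/-- **(o) The generator of `φ_β(Γ₀(N))` is nonzero and `‖g'‖₂ ≥ 2⁻³`** (odd admissible level): the tree's odd `C`-witness
`‖v(m, a)‖₂ = 8⁻¹` (`exists_inC_norm_stabEisCuspDiff_eq`) is a difference of two values of `φ_β` on `Γ₀(N)`.
[cite: Stevens1982, §2.5 (PDF p. 38)] [cite: Stevens1985, Thm. 1.3(a) (PDF p. 5)] -/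
theorem generator_ne_zero_and_norm_ge (hodd : Odd N) (hadm : IsAdmissibleStabData N β) {g' : ℚ}
    (hg : ∀ x : ℚ, (∃ γ : Gamma0 N, stabEisensteinPeriod N β ((γ : SL(2, ℤ)) 0 0) ((γ : SL(2, ℤ)) 0 1)
      ((γ : SL(2, ℤ)) 1 0) ((γ : SL(2, ℤ)) 1 1) = x) ↔ ∃ n : ℤ, x = n * g') :
    g' ≠ 0 ∧ 8⁻¹ ≤ ‖((g' : ℚ) : ℚ_[2])‖ := by
  obtain ⟨m, a, hma, hv⟩ := exists_inC_norm_stabEisCuspDiff_eq hodd hadm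
  have ha : Odd a := by
    obtain ⟨-, h4, -, -⟩ := hma
    exact Int.odd_iff.mpr (by omega)
  have hval : ∀ {b : ℤ}, Odd b → ∃ n : ℤ, stabEisensteinPeriod N β (Int.gcdA ((2 ^ m : ℕ) : ℤ) (b * N)) b
      (-(N : ℤ) * Int.gcdB ((2 ^ m : ℕ) : ℤ) (b * N)) ((2 ^ m : ℕ) : ℤ) = n * g' := by
    intro b hb
    obtain ⟨γ, h00, h01, h10, h11⟩ := exists_sl_gammaEntries hodd m hb
    have hmem : γ ∈ Gamma0 N := by
      rw [Gamma0_mem, h10]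
      push_cast
      rw [ZMod.natCast_self, neg_zero, zero_mul]
    obtain ⟨n, hn⟩ := (hg _).mp ⟨⟨γ, hmem⟩, rfl⟩
    refine ⟨n, ?_⟩
    have hn' : stabEisensteinPeriod N β (γ 0 0) (γ 0 1) (γ 1 0) (γ 1 1) = n * g' := hn
    rwa [h00, h01, h10, h11] at hn'
  obtain ⟨na, hna⟩ := hval ha
  obtain ⟨n1, hn1⟩ := hval odd_one
  have hvq : stabEisCuspDiff N β m a = ((na - n1 : ℤ) : ℚ) * g' := by
    rw [stabEisCuspDiff_eq, hna, hn1]; push_cast; ring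
  constructor
  · rintro rfl
    rw [hvq, mul_zero, Rat.cast_zero, norm_zero] at hv
    norm_num at hv
  · rw [hvq, Rat.cast_mul, Rat.cast_intCast, norm_mul] at hv
    calc (8 : ℝ)⁻¹ = ‖((na - n1 : ℤ) : ℚ_[2])‖ * ‖((g' : ℚ) : ℚ_[2])‖ := hv.symm
      _ ≤ 1 * ‖((g' : ℚ) : ℚ_[2])‖ := by gcongr; exact Padic.norm_int_le_one _
      _ = _ := one_mul _

/-- **(ii-a) CUSP-EVENNESS on `Γ₀(N)`.** For odd admissible `(N, β)` with `N` not a square `ℓ²`, `ℓ ≡ ±3 (mod 8)`: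
every PARABOLIC `γ ∈ Γ₀(N)` (trace `2`) has `φ_β(γ) ∈ 2g'ℤ`, `g'` the generator of `φ_β(Γ₀(N))` — by the parabolic
normal form `γ = σT^hσ⁻¹`, the closed formula `φ_β(γ) = h·S(c)` (CF) and (E-LEG) `‖S(c)‖₂ ≤ 2⁻⁴ < 2⁻³ ≤ ‖g'‖₂`.
At `N = ℓ²`, `ℓ ≡ ±3 (8)` it FAILS even on `Γ₁(N)` (cusp `1/ℓ`, `h = ℓ`: `φ_β/g'` odd; kit j312110).
[cite: Stevens1982, Thm. 1.3.4 + §2.5 (PDF pp. 22, 38)] [cite: Stevens1985, Thm. 1.3 (PDF p. 5)] -/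
theorem parabolic_even (hodd : Odd N) (hadm : IsAdmissibleStabData N β)
    (hexc : ∀ ℓ : ℕ, ℓ.Prime → N = ℓ ^ 2 → ℓ % 8 = 1 ∨ ℓ % 8 = 7) {g' : ℚ}
    (hg : ∀ x : ℚ, (∃ γ : Gamma0 N, stabEisensteinPeriod N β ((γ : SL(2, ℤ)) 0 0) ((γ : SL(2, ℤ)) 0 1)
      ((γ : SL(2, ℤ)) 1 0) ((γ : SL(2, ℤ)) 1 1) = x) ↔ ∃ n : ℤ, x = n * g')
    (γ : SL(2, ℤ)) (hγ : γ ∈ Gamma0 N) (htr : (γ : Matrix (Fin 2) (Fin 2) ℤ).trace = 2) :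
    ∃ n : ℤ, stabEisensteinPeriod N β (γ 0 0) (γ 0 1) (γ 1 0) (γ 1 1) = n * g' ∧ Even n := by
  have hN : N ≠ 0 := fun h ↦ by simp [h] at hodd
  obtain ⟨n, hn⟩ := (hg _).mp ⟨⟨γ, hγ⟩, rfl⟩
  have hn' : stabEisensteinPeriod N β (γ 0 0) (γ 0 1) (γ 1 0) (γ 1 1) = n * g' := hn
  refine ⟨n, hn', ?_⟩
  obtain ⟨σ, h, rfl⟩ := exists_eq_conj_T_zpow_of_trace_eq_two γ htr
  have hc : (N : ℤ) ∣ (σ * ModularGroup.T ^ h * σ⁻¹) 1 0 := (ZMod.intCast_zmod_eq_zero_iff_dvd _ N).mp (Gamma0_mem.mp hγ)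
  rw [(conj_T_zpow_apply σ h).2.2.1, dvd_neg] at hc
  have hval := stabEisensteinPeriod_conj_T_zpow hN hadm σ h hc
  rw [hn'] at hval
  refine even_of_norm_mul_le (generator_ne_zero_and_norm_ge hodd hadm hg).2 ?_
  rw [hval]
  simp only [int_gcd_natCast_left]
  rw [Rat.cast_mul, norm_mul, Rat.cast_intCast]
  calc ‖(h : ℚ_[2])‖ * _ ≤ 1 * (2 : ℝ) ^ (-(4 : ℤ)) := by
        gcongr
        · exact Padic.norm_int_le_one _
        · exact norm_cuspSum_le hN hodd hadm hexc _
    _ = _ := one_mul _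

/-- (ii-a) restricted to `Γ₁(N) ≤ Γ₀(N)` — the literal shape of the lead's clause. [cite: Stevens1985, Thm. 1.3 (PDF p. 5)] -/
theorem parabolic_even_gamma1 (hodd : Odd N) (hadm : IsAdmissibleStabData N β)
    (hexc : ∀ ℓ : ℕ, ℓ.Prime → N = ℓ ^ 2 → ℓ % 8 = 1 ∨ ℓ % 8 = 7) {g' : ℚ}
    (hg : ∀ x : ℚ, (∃ γ : Gamma0 N, stabEisensteinPeriod N β ((γ : SL(2, ℤ)) 0 0) ((γ : SL(2, ℤ)) 0 1)
      ((γ : SL(2, ℤ)) 1 0) ((γ : SL(2, ℤ)) 1 1) = x) ↔ ∃ n : ℤ, x = n * g') :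
    ∀ γ : SL(2, ℤ), γ ∈ Gamma1 N → (γ : Matrix (Fin 2) (Fin 2) ℤ).trace = 2 →
      ∃ n : ℤ, stabEisensteinPeriod N β (γ 0 0) (γ 0 1) (γ 1 0) (γ 1 1) = n * g' ∧ Even n :=
  fun γ hγ htr ↦ parabolic_even hodd hadm hexc hg γ (Gamma1_in_Gamma0 N hγ) htr

/-- Sign normalisation: the value of `φ_β` at `γ ∈ Γ₀(N)` (`N > 1`) is its value on entries `(A, B; C, D)` with
`AD − BC = 1`, `N ∣ C` and `D > 0` (replace `γ` by `−γ`, `φ_β(−γ) = φ_β(γ)`). [cite: RademacherGrosswald1972, Ch. 4 A, eq. (62)] -/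
theorem exists_pos_entries (hN1 : 1 < N) (γ : SL(2, ℤ)) (hγ : γ ∈ Gamma0 N) :
    ∃ A B C D : ℤ, A * D - B * C = 1 ∧ (N : ℤ) ∣ C ∧ 0 < D ∧
      stabEisensteinPeriod N β (γ 0 0) (γ 0 1) (γ 1 0) (γ 1 1) = stabEisensteinPeriod N β A B C D := by
  have hdet : γ 0 0 * γ 1 1 - γ 0 1 * γ 1 0 = 1 := by
    have := Matrix.SpecialLinearGroup.det_coe γ
    rwa [Matrix.det_fin_two] at this
  have hC : (N : ℤ) ∣ γ 1 0 := (ZMod.intCast_zmod_eq_zero_iff_dvd _ N).mp (Gamma0_mem.mp hγ)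
  rcases lt_trichotomy 0 (γ 1 1) with hpos | hzero | hneg
  · exact ⟨_, _, _, _, hdet, hC, hpos, rfl⟩
  · exfalso
    rw [← hzero, mul_zero, zero_sub] at hdet
    have h1 : (N : ℤ) ∣ 1 := by
      rw [show (1 : ℤ) = -(γ 0 1) * γ 1 0 by linear_combination -hdet]
      exact Dvd.dvd.mul_left hC _
    have := Int.eq_one_of_dvd_one (by positivity) h1
    omega
  · refine ⟨-γ 0 0, -γ 0 1, -γ 1 0, -γ 1 1, by linear_combination hdet, (dvd_neg).mpr hC, by linarith, ?_⟩
    rw [stabEisensteinPeriod_neg_of_dvd hC]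

/-- **Bézout factorisation.** For `AD − BC = 1`, `N ∣ C`: `gcd(D, BN) = 1` and `(A B; C D) = γ_{B,D}·(1 0; k 1)` with
`N ∣ k`, so `φ_β(A, B; C, D) = φ_β(γ_{B,D}) + φ_β(1, 0; k, 1)` by additivity on `Γ₀(N)`.
[cite: Stevens1982, §2.5 eq. (2.5.3) (PDF p. 38)] [cite: RademacherGrosswald1972, Ch. 4 A, eq. (62)] -/
theorem bezout_lower_split (hN : N ≠ 0) (hadm : IsAdmissibleStabData N β) {A B C D : ℤ}
    (hdet : A * D - B * C = 1) (hC : (N : ℤ) ∣ C) :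
    Int.gcd D (B * N) = 1 ∧ ∃ k : ℤ, (N : ℤ) ∣ k ∧
      stabEisensteinPeriod N β A B C D =
        stabEisensteinPeriod N β (Int.gcdA D (B * N)) B (-(N : ℤ) * Int.gcdB D (B * N)) D +
          stabEisensteinPeriod N β 1 0 k 1 := by
  obtain ⟨C', hC'⟩ := hC
  have hcop : Int.gcd D (B * N) = 1 :=
    Int.isCoprime_iff_gcd_eq_one.mp ⟨A, -C', by rw [hC'] at hdet; linear_combination hdet⟩
  have hbez : D * Int.gcdA D (B * N) + B * N * Int.gcdB D (B * N) = 1 := by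
    have := Int.gcd_eq_gcd_ab D (B * N); rw [hcop] at this; push_cast at this; linear_combination -this
  let e : SL(2, ℤ) := ⟨!![Int.gcdA D (B * N), B; -(N : ℤ) * Int.gcdB D (B * N), D], by
    rw [Matrix.det_fin_two_of]; linear_combination hbez⟩
  let γ₁ : SL(2, ℤ) := ⟨!![A, B; C, D], by rw [Matrix.det_fin_two_of]; linear_combination hdet⟩
  have e00 : e 0 0 = Int.gcdA D (B * N) := rfl
  have e01 : e 0 1 = B := rfl
  have e10 : e 1 0 = -(N : ℤ) * Int.gcdB D (B * N) := rfl
  have e11 : e 1 1 = D := rfl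
  have g00 : γ₁ 0 0 = A := rfl
  have g01 : γ₁ 0 1 = B := rfl
  have g10 : γ₁ 1 0 = C := rfl
  have g11 : γ₁ 1 1 = D := rfl
  have i00 : (e⁻¹ : SL(2, ℤ)) 0 0 = D := by
    simp [Matrix.SpecialLinearGroup.coe_inv, Matrix.adjugate_fin_two, e11]
  have i01 : (e⁻¹ : SL(2, ℤ)) 0 1 = -B := by
    simp [Matrix.SpecialLinearGroup.coe_inv, Matrix.adjugate_fin_two, e01]
  have i10 : (e⁻¹ : SL(2, ℤ)) 1 0 = (N : ℤ) * Int.gcdB D (B * N) := by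
    simp [Matrix.SpecialLinearGroup.coe_inv, Matrix.adjugate_fin_two, e10]
  have i11 : (e⁻¹ : SL(2, ℤ)) 1 1 = Int.gcdA D (B * N) := by
    simp [Matrix.SpecialLinearGroup.coe_inv, Matrix.adjugate_fin_two, e00]
  set L : SL(2, ℤ) := e⁻¹ * γ₁ with hL
  have mulL : ∀ i j : Fin 2, L i j = (e⁻¹ : SL(2, ℤ)) i 0 * γ₁ 0 j + (e⁻¹ : SL(2, ℤ)) i 1 * γ₁ 1 j := by
    intro i j
    change ((e⁻¹ : SL(2, ℤ)) * γ₁ : SL(2, ℤ)) i j = _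
    simp [Matrix.SpecialLinearGroup.coe_mul, Matrix.mul_apply, Fin.sum_univ_two]
  have l00 : L 0 0 = 1 := by rw [mulL, i00, i01, g00, g10]; linear_combination hdet
  have l01 : L 0 1 = 0 := by rw [mulL, i00, i01, g01, g11]; ring
  have l11 : L 1 1 = 1 := by rw [mulL, i10, i11, g01, g11]; linear_combination hbez
  have hkN : (N : ℤ) ∣ L 1 0 := by
    rw [mulL, i10, i11, g00, g10, hC']
    exact ⟨Int.gcdB D (B * N) * A + Int.gcdA D (B * N) * C', by ring⟩
  have heN : (N : ℤ) ∣ e 1 0 := by rw [e10]; exact ⟨-Int.gcdB D (B * N), by ring⟩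
  have hprod : e * L = γ₁ := by rw [hL]; group
  have hadd := stabEisensteinPeriod_mul hN hadm (A := e) (B := L) heN hkN
  rw [hprod, g00, g01, g10, g11, e00, e01, e10, e11, l00, l01, l11] at hadd
  exact ⟨hcop, L 1 0, hkN, hadd⟩

/-- The lower unipotents of `Γ₀(N)` take EVEN multiples of the generator: `φ_β(1, 0; k, 1) = −k c_β ∈ 2g'ℤ`
(`‖c_β‖₂ ≤ 2⁻⁴`, tree `norm_cBeta_le`; `‖g'‖₂ ≥ 2⁻³`). [cite: Stevens1982, §2.4 (PDF pp. 35–37)] -/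
theorem lower_value_even (hodd : Odd N) (hadm : IsAdmissibleStabData N β) {g' : ℚ}
    (hg : ∀ x : ℚ, (∃ γ : Gamma0 N, stabEisensteinPeriod N β ((γ : SL(2, ℤ)) 0 0) ((γ : SL(2, ℤ)) 0 1)
      ((γ : SL(2, ℤ)) 1 0) ((γ : SL(2, ℤ)) 1 1) = x) ↔ ∃ n : ℤ, x = n * g') {k : ℤ} (hk : (N : ℤ) ∣ k) :
    ∃ j : ℤ, stabEisensteinPeriod N β 1 0 k 1 = j * g' ∧ Even j := by
  have hN : N ≠ 0 := fun h ↦ by simp [h] at hodd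
  let L : SL(2, ℤ) := ⟨!![1, 0; k, 1], by rw [Matrix.det_fin_two_of]; ring⟩
  have hLmem : L ∈ Gamma0 N := by
    rw [Gamma0_mem]; exact (ZMod.intCast_zmod_eq_zero_iff_dvd _ N).mpr hk
  obtain ⟨j, hj⟩ := (hg _).mp ⟨⟨L, hLmem⟩, rfl⟩
  have hj' : stabEisensteinPeriod N β 1 0 k 1 = j * g' := hj
  refine ⟨j, hj', even_of_norm_mul_le (generator_ne_zero_and_norm_ge hodd hadm hg).2 ?_⟩
  rw [← hj', stabEisensteinPeriod_lower hN hadm hk, Rat.cast_mul, norm_mul, Rat.cast_neg, norm_neg, Rat.cast_intCast]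
  calc ‖(k : ℚ_[2])‖ * _ ≤ 1 * (2 : ℝ) ^ (-(4 : ℤ)) := by
        gcongr
        · exact Padic.norm_int_le_one _
        · exact norm_cBeta_le hN hodd hadm
    _ = _ := one_mul _

/-- **(iii) An odd cusp value.** For odd admissible `(N, β)`: some Bézout matrix `γ_{b,d} = (x, b; −Ny, d)`, `d > 0`,
`gcd(d, bN) = 1`, has `φ_β(γ_{b,d}) = n'·g'` with `n'` ODD — take `γ₀ ∈ Γ₀(N)` with `φ_β(γ₀) = g'` and factor
`γ₀ = γ_{b,d}·(1, 0; k, 1)`, `N ∣ k`, where `φ_β(1, 0; k, 1) ∈ 2g'ℤ`.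
[cite: Stevens1982, §2.5 eq. (2.5.3) (PDF p. 38)] [cite: Stevens1985, Thm. 1.3 (PDF p. 5)] -/
theorem exists_odd_bezout_value (hodd : Odd N) (hadm : IsAdmissibleStabData N β) {g' : ℚ}
    (hg : ∀ x : ℚ, (∃ γ : Gamma0 N, stabEisensteinPeriod N β ((γ : SL(2, ℤ)) 0 0) ((γ : SL(2, ℤ)) 0 1)
      ((γ : SL(2, ℤ)) 1 0) ((γ : SL(2, ℤ)) 1 1) = x) ↔ ∃ n : ℤ, x = n * g') :
    ∃ b d : ℤ, 0 < d ∧ Int.gcd d (b * N) = 1 ∧ ∃ n' : ℤ,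
      stabEisensteinPeriod N β (Int.gcdA d (b * N)) b (-(N : ℤ) * Int.gcdB d (b * N)) d = n' * g' ∧ Odd n' := by
  have hN : N ≠ 0 := fun h ↦ by simp [h] at hodd
  obtain ⟨γ₀, hγ₀⟩ := (hg g').mpr ⟨1, by simp⟩
  obtain ⟨A, B, C, D, hdet, hC, hD, hφ⟩ := exists_pos_entries (β := β) (one_lt_of_admissible hadm) _ γ₀.2
  obtain ⟨hcop, k, hk, hsplit⟩ := bezout_lower_split hN hadm hdet hC
  obtain ⟨j, hj, hjeven⟩ := lower_value_even hodd hadm hg hk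
  rw [← hφ, hγ₀, hj] at hsplit
  refine ⟨B, D, hD, hcop, 1 - j, by push_cast; linear_combination -hsplit, ?_⟩
  obtain ⟨r, hr⟩ := hjeven
  exact ⟨-r, by omega⟩

/-- **Every value of `φ_β` on `Γ₀(N)` has `‖·‖₂ ≤ 2⁻³`** (odd admissible level): Bézout factorisation + the tree's
(★-EisEightGlobal) `star_eisEightGlobal` on `γ_{b,d}` + `φ_β(1, 0; k, 1) = −k c_β`. Hence `‖g'‖₂ = 2⁻³` exactly
(`norm_generator_eq`). [cite: Stevens1982, §2.4–2.5 (PDF pp. 35–38)] -/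
theorem norm_value_le_eighth (hodd : Odd N) (hadm : IsAdmissibleStabData N β) (γ : SL(2, ℤ)) (hγ : γ ∈ Gamma0 N) :
    ‖((stabEisensteinPeriod N β (γ 0 0) (γ 0 1) (γ 1 0) (γ 1 1) : ℚ) : ℚ_[2])‖ ≤ 8⁻¹ := by
  have hN : N ≠ 0 := fun h ↦ by simp [h] at hodd
  obtain ⟨A, B, C, D, hdet, hC, hD, hφ⟩ := exists_pos_entries (β := β) (one_lt_of_admissible hadm) γ hγ
  obtain ⟨hcop, k, hk, hsplit⟩ := bezout_lower_split hN hadm hdet hC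
  rw [hφ, hsplit, Rat.cast_add]
  refine (Padic.nonarchimedean _ _).trans (max_le (star_eisEightGlobal N hodd β hadm B D hD hcop) ?_)
  rw [stabEisensteinPeriod_lower hN hadm hk, Rat.cast_mul, norm_mul, Rat.cast_neg, norm_neg, Rat.cast_intCast]
  calc ‖(k : ℚ_[2])‖ * _ ≤ 1 * (2 : ℝ) ^ (-(4 : ℤ)) := by
        gcongr
        · exact Padic.norm_int_le_one _
        · exact norm_cBeta_le hN hodd hadm
    _ ≤ 8⁻¹ := by norm_num

/-- **`‖g'‖₂ = 2⁻³`**: the generator of `φ_β(Γ₀(N))` has exact `2`-content `8` (odd admissible level).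
[cite: Stevens1982, §2.5 (PDF p. 38)] [cite: Stevens1985, Thm. 1.3(a) (PDF p. 5)] -/
theorem norm_generator_eq (hodd : Odd N) (hadm : IsAdmissibleStabData N β) {g' : ℚ}
    (hg : ∀ x : ℚ, (∃ γ : Gamma0 N, stabEisensteinPeriod N β ((γ : SL(2, ℤ)) 0 0) ((γ : SL(2, ℤ)) 0 1)
      ((γ : SL(2, ℤ)) 1 0) ((γ : SL(2, ℤ)) 1 1) = x) ↔ ∃ n : ℤ, x = n * g') :
    ‖((g' : ℚ) : ℚ_[2])‖ = 8⁻¹ := by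
  refine le_antisymm ?_ (generator_ne_zero_and_norm_ge hodd hadm hg).2
  obtain ⟨γ₀, hγ₀⟩ := (hg g').mpr ⟨1, by simp⟩
  rw [← hγ₀]
  exact norm_value_le_eighth hodd hadm _ γ₀.2

end Core


end Summit.BirchSwinnertonDyer.BirchSwinnertonDyer.Theorems.DepletionAtTwo.CuspEvenness
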